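import Summits.Ventures.YMGap.FlowData.RectTubeVacuumSector
import Mathlib.Analysis.InnerProductSpace.Projection.Basic
import HarnessLib

/-!
# Venture YMGap, track Y3 FLOW-DATA — the VACUUM PROJECTION of a transfer operator and the typed `e = 0` GAP `m′`
# (FLOW-PLAN O5: `m′ = ln(λ̂₀/λ̂*)`, `λ̂*` = second-largest eigenvalue on the whole flux-`0` space) — DEFINITIONS

HONEST FRAMING: venture file of the cell `pub-ymgap` (QuantumFields programme), track Y3 (FLOW-DATA); companion
DEFINITIONS for `FlowData/RectTubeTransferOperator.lean` / `RectTubeVacuumSector.lean`.  It TYPES the FLOW-TABLE's `m′`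
rows («true finite-volume gap of the e = 0 theory») by OPERATOR NORMS: no spectral theorem beyond the tree's Jentzsch /
Perron–Frobenius file is needed to state them.  Finite spatial torus; no number, no row, nothing about `L → ∞`, the
continuum or a (thermodynamic / continuum) mass gap — `m′` here is a number attached to ONE finite tube.

* Abstract layer (real Hilbert space `H`, `T : H →L[ℝ] H`): `topEigenspace T = ker (T − ‖T‖)` (closed, hence complete, hence
  it has an orthogonal projection), **`vacuumProjection T`** = the orthogonal (star) projection onto it, as an operator on `H`;
  `vacuumProjection_eq_of_simple` — when `‖T‖` is a simple eigenvalue with unit eigenvector `φ₀`, `P_Ω ψ = ⟪φ₀, ψ⟫ φ₀`;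
  `excitedSectorNorm T C = ‖T ∘ (P_0 − P_Ω)‖` (`P_0 = fluxProjection C 0` the trivial-flux projection) and
  **`massGapPrime T C = log ‖T‖ − log ‖T ∘ (P_0 − P_Ω)‖`** (junk value `log ‖T‖` when the excited `e = 0` space is
  annihilated, e.g. at `β = 0`).
* Tube layer: `rectTubeVacuumProjection ρ J Ls`, `rectTubeExcitedNorm ρ z J Ls`, **`rectTubeMassGapPrime ρ z J Ls`**, and the
  cell's **`su2RectMassGapPrime β Ls`** (`SU(2)` fundamental, `z = −1`, `J = β/2`; cubic cross-sections are the case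
  `Ls = fun _ => L`).  For the tube operator (compact, self-adjoint, positivity improving: `RectTubeVacuumSector.exists_rectVacuum`)
  the top eigenvalue is simple with a strictly positive, twist-invariant eigenvector `φ₀ ∈` sector `0`, so `P_Ω ≤ P_0`,
  `P_0 − P_Ω` is the orthogonal projection onto the excited trivial-flux space and `‖T ∘ (P_0 − P_Ω)‖ = λ̂*` is the top of
  `T` there (all momenta and point-group labels included) — FLOW-PLAN O5.  Theorems (`‖T ∘ (P_0 − P_Ω)‖ < ‖T‖`, hence
  `m′ > 0` whenever that space is not annihilated; witnesses) are in `FlowData/RectTubeMassGapPrime.lean`.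

References: M. Reed, B. Simon, *Methods of Modern Mathematical Physics IV* (1978) Thm. XIII.43–44
[cite: ReedSimonIV1978, §XIII.12]; M. Lüscher, Commun. Math. Phys. 54 (1977) 283 [cite: Luscher1977]; I. Montvay, G. Münster
(1994) §3.2.6 [cite: MontvayMunster1994, §3.2.6].
-/

noncomputable section

open scoped BigOperators ENNReal InnerProductSpace
open MeasureTheory Filter Function
open Literature.MathematicalPhysics.QuantumFieldTheory Literature.Analysis.OperatorTheory
open Literature.MathematicalPhysics.QuantumLattice (RectTorusSite fundamentalRep)

namespace Summit.Ventures.YMGap.FlowData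

/-! ### Abstract layer: the top eigenspace, the vacuum projection, the excited `e = 0` norm and `m′` -/

section Abstract

variable {H : Type*} [NormedAddCommGroup H] [InnerProductSpace ℝ H]

/-- The **top eigenspace** `ker (T − ‖T‖·1)` of a bounded operator (`{η : T η = ‖T‖ η}`; for the tube transfer operator
the vacuum line `ℝ φ₀`). -/
def topEigenspace (T : H →L[ℝ] H) : Submodule ℝ H :=
  LinearMap.ker ((T - ‖T‖ • (1 : H →L[ℝ] H)).toLinearMap)

/-- `η ∈ topEigenspace T ↔ T η = ‖T‖ η`. [folklore] -/
theorem mem_topEigenspace_iff (T : H →L[ℝ] H) (η : H) : η ∈ topEigenspace T ↔ T η = ‖T‖ • η := by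
  unfold topEigenspace
  rw [LinearMap.mem_ker, ContinuousLinearMap.coe_coe]
  change T η - ‖T‖ • η = 0 ↔ _
  rw [sub_eq_zero]

/-- The top eigenspace is closed. [folklore] -/
theorem isClosed_topEigenspace (T : H →L[ℝ] H) : IsClosed (topEigenspace T : Set H) :=
  ContinuousLinearMap.isClosed_ker (T - ‖T‖ • (1 : H →L[ℝ] H))

variable [CompleteSpace H]

/-- The top eigenspace of an operator on a Hilbert space is complete (it is closed). [folklore] -/
instance completeSpace_topEigenspace (T : H →L[ℝ] H) : CompleteSpace (topEigenspace T) :=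
  (isClosed_topEigenspace T).completeSpace_coe

/-- **The vacuum projection**: the orthogonal projection onto the top eigenspace `ker (T − ‖T‖)`, as an operator on `H`
(for the tube transfer operator: `ψ ↦ ⟪φ₀, ψ⟫ φ₀`, `vacuumProjection_eq_of_simple`). -/
def vacuumProjection (T : H →L[ℝ] H) : H →L[ℝ] H :=
  (topEigenspace T).starProjection

/-- `‖P_Ω‖ ≤ 1`. [folklore] -/
theorem norm_vacuumProjection_le_one (T : H →L[ℝ] H) : ‖vacuumProjection T‖ ≤ 1 :=
  Submodule.starProjection_norm_le _

/-- **When the top eigenvalue is simple** with unit eigenvector `φ₀` (`T φ₀ = ‖T‖ φ₀` and every `η` with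
`T η = ‖T‖ η` equals `⟪φ₀, η⟫ φ₀`), the vacuum projection is the rank-one projection `P_Ω ψ = ⟪φ₀, ψ⟫ φ₀`.
[cite: ReedSimonIV1978, §XIII.12] -/
theorem vacuumProjection_eq_of_simple (T : H →L[ℝ] H) {φ₀ : H} (h1 : ‖φ₀‖ = 1) (heig : T φ₀ = ‖T‖ • φ₀)
    (hsimple : ∀ η : H, T η = ‖T‖ • η → η = ⟪φ₀, η⟫_ℝ • φ₀) (ψ : H) :
    vacuumProjection T ψ = ⟪φ₀, ψ⟫_ℝ • φ₀ := by
  unfold vacuumProjection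
  refine Submodule.eq_starProjection_of_mem_orthogonal ?_ ?_
  · rw [mem_topEigenspace_iff, map_smul, heig, smul_smul, smul_smul, mul_comm]
  · rw [Submodule.mem_orthogonal]
    intro η hη
    rw [mem_topEigenspace_iff] at hη
    have hη' := hsimple η hη
    have hφφ : ⟪φ₀, φ₀⟫_ℝ = 1 := by rw [real_inner_self_eq_norm_sq, h1, one_pow]
    rw [hη', real_inner_smul_left, inner_sub_right, real_inner_smul_right, hφφ, mul_one, sub_self, mul_zero]

variable {k : ℕ}

/-- The **excited trivial-flux norm** `‖T ∘ (P_0 − P_Ω)‖` (`P_0 = fluxProjection C 0`): for the tube operator the top of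
`T` on the flux-`0` states orthogonal to the vacuum — FLOW-PLAN O5's `λ̂*` up to the common scalar. -/
def excitedSectorNorm (T : H →L[ℝ] H) (C : (Fin k → ZMod 2) → H →L[ℝ] H) : ℝ :=
  ‖T.comp (fluxProjection C 0 - vacuumProjection T)‖

/-- **`m′ = log ‖T‖ − log ‖T ∘ (P_0 − P_Ω)‖`**: the gap between the vacuum and the rest of the trivial-flux sector
(FLOW-PLAN O5 `m′ = ln(λ̂₀/λ̂*)`; junk value when the excited space is annihilated). -/
def massGapPrime (T : H →L[ℝ] H) (C : (Fin k → ZMod 2) → H →L[ℝ] H) : ℝ :=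
  Real.log ‖T‖ - Real.log (excitedSectorNorm T C)

/-- `0 ≤ excitedSectorNorm`. [folklore] -/
theorem excitedSectorNorm_nonneg (T : H →L[ℝ] H) (C : (Fin k → ZMod 2) → H →L[ℝ] H) : 0 ≤ excitedSectorNorm T C :=
  norm_nonneg _

end Abstract

/-! ### Tube layer and the cell's object -/

section Tube

variable {G : Type*} [Group G] [TopologicalSpace G] [IsTopologicalGroup G] [CompactSpace G]
  [MeasurableSpace G] [BorelSpace G] {n k : ℕ} (ρ : G →* Matrix (Fin n) (Fin n) ℂ) (z : G) (J : ℝ)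
  (Ls : Fin k → ℕ) [∀ i, NeZero (Ls i)]

/-- The vacuum projection of the rectangular tube transfer operator. -/
def rectTubeVacuumProjection : Lp ℝ 2 (rectSliceMeasure G Ls) →L[ℝ] Lp ℝ 2 (rectSliceMeasure G Ls) :=
  vacuumProjection (rectTubeTransferOperator ρ J Ls)

/-- The excited trivial-flux norm `‖T ∘ (P_0 − P_Ω)‖` of the rectangular tube (FLOW-PLAN `λ̂*` up to the common scalar). -/
def rectTubeExcitedNorm : ℝ :=
  excitedSectorNorm (rectTubeTransferOperator ρ J Ls) (rectFluxTwistOp Ls z)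

/-- **The `e = 0` gap `m′` of the rectangular tube**: `log ‖T‖ − log ‖T ∘ (P_0 − P_Ω)‖` (FLOW-PLAN O5). -/
def rectTubeMassGapPrime : ℝ :=
  massGapPrime (rectTubeTransferOperator ρ J Ls) (rectFluxTwistOp Ls z)

/-- `m′` unfolds to the difference of logarithms. [folklore] -/
theorem rectTubeMassGapPrime_eq :
    rectTubeMassGapPrime ρ z J Ls =
      Real.log ‖rectTubeTransferOperator ρ J Ls‖ - Real.log (rectTubeExcitedNorm ρ z J Ls) := rfl

end Tube

section SU2

/-- **The cell's `e = 0` gap `m′(β; Π_i ℤ/(Ls i))`**: `SU(2)`, fundamental representation, `z = −1`, Wilson coupling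
`β ≡ β_W` (`J = β/2`); the FLOW-TABLE's `m′` rows (cubic cross-sections: `Ls = fun _ => L`). -/
def su2RectMassGapPrime {k : ℕ} (β : ℝ) (Ls : Fin k → ℕ) [∀ i, NeZero (Ls i)] : ℝ :=
  rectTubeMassGapPrime (fundamentalRep (Fin 2)) su2MinusOne (β / 2) Ls

/-- The cell's excited trivial-flux norm `λ̂*` (un-normalised). -/
def su2RectExcitedNorm {k : ℕ} (β : ℝ) (Ls : Fin k → ℕ) [∀ i, NeZero (Ls i)] : ℝ :=
  rectTubeExcitedNorm (fundamentalRep (Fin 2)) su2MinusOne (β / 2) Ls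

/-- `su2RectMassGapPrime` unfolds to `log ‖T‖ − log λ̂*`. [folklore] -/
theorem su2RectMassGapPrime_eq {k : ℕ} (β : ℝ) (Ls : Fin k → ℕ) [∀ i, NeZero (Ls i)] :
    su2RectMassGapPrime β Ls =
      Real.log ‖rectTubeTransferOperator (fundamentalRep (Fin 2)) (β / 2) Ls‖ - Real.log (su2RectExcitedNorm β Ls) := rfl

end SU2

end Summit.Ventures.YMGap.FlowData
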